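import Literature.Computability.AlgebraicComplexity.CircuitCodeModularEvaluator
import Literature.Computability.Complexity.CodeFPArith
import HarnessLib

/-!
# Typed wrappers for explicit-point evaluation of circuit codes modulo an explicit modulus

Topic `Computability/AlgebraicComplexity`. The verifiers of the `∃·BPP` protocols behind BIJL18
Thms 4–6 (Bläser–Ikenmeyer–Jindal–Lysikov 2018, §6: the guessed circuits are checked "by random
evaluation modulo a prime"; route of record `MEMO-p1g6-BIJL18-thm6-route.md`, brick B4) call the
tree's string-level bricks — the point/modulus evaluator `CircuitCode.evalAtF` (`evalAtF_spec`), the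
formal-degree test `CircuitCode.fdegLeF` (`fdegLeF_spec`), the AKS primality machine
`AKSMachine.aksFn` (`aksFn_encodeNat`) — on records assembled from TYPED data (a modulus `r : ℕ`, a
code `w`, a point `xs : List ℕ`, a block width `b`). This file packages them in the tree's typed
`CodeFP` calculus (`Complexity/CodeFP.lean`, `CodeFPArith.lean`), so that such a verifier is a
composition of typed maps:

* §1 fixed-width blocks: `zeroBits n = 0ⁿ` (a one-state transducer), `blockE b x` (the number `x`
  written in exactly `b` bits, value `x` when `x < 2^b`), `segE b xs` (the point segment of a list of
  coordinates: `|xs|` blocks), with `ModularZeroTest.ptOf b V (segE b xs) i = xs.getD i 0` and the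
  codes `zeroBitsFP` / `blockEFP` / `segEFP`;
* §2 **`CircuitCode.evalPt r w xs b : ℕ`** — the residue modulo `r` of the value at the point
  `i ↦ xs.getD i 0` of the circuit read off `w` (`CircuitCode.semPoly w`), with
  `evalPt_spec : (evalPt r w xs b : ℤ) = (semPoly w)(xs) % r` (`2 ≤ r`, `|xs| = |w|`, `xs < 2^b`),
  `natCast_evalPt_zmod` (the same in `ZMod r`), `evalPt_lt`, and
  **`evalPtFP : CodeFP (pairE natE (pairE strE (pairE (rawE natE) unE))) natE …`**;
* §3 `CircuitCode.fdegLe w d : Bool` = `[formalDegree (rdCircuit V w) ≤ d]` (independent of `V`)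
  with `fdegLeFP`, and `fdegLe_circuitWord` on genuine code words;
* §4 primality in binary is already typed in the tree: `VDSOracle.codeFP_prime` (pointer only).

Definitions are plumbing (`zeroBitsT`, `zeroBits`, `blockE`, `segE`, `evalPt`, `fdegLe`); no named
facts. Honest framing: machine bookkeeping for a 2018 conditional barrier's verifier; nothing here
bears on `VP` versus `VNP`.

## References

* [BlaserIkenmeyerJindalLysikov2018] M. Bläser, C. Ikenmeyer, G. Jindal, V. Lysikov, *Generalized
  matrix completion and algebraic natural proofs*, STOC 2018 / ECCC TR18-064, §6 (proof of Thm. 5: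
  "we choose a prime `p`", "by random evaluation", steps 2–3 and 5–7).
* [AroraBarakCC2009] S. Arora, B. Barak, *Computational Complexity*, CUP 2009, §1.3 (polynomial time
  is closed under composition and bounded loops), §7.2.3, Lemma 7.5.
* [AgrawalKayalSaxena2004] M. Agrawal, N. Kayal, N. Saxena, *PRIMES is in P*, Ann. Math. 160 (2004),
  Thm 4.1 / 5.1 (the tree's `AKSMachine.aksFn`).
-/

noncomputable section

namespace Literature.Computability.AlgebraicComplexity

open _root_.Computability Complexity Complexity.CodeFP Brick ModularZeroTest

namespace CircuitCode

/-! ## §1 Fixed-width blocks and point segments -/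

/-- The one-state transducer emitting `0` per input symbol. [folklore] -/
def zeroBitsT : FST Unit Bool Bool where
  init := ()
  step := fun _ _ => ((), [false])
  front := fun _ => []
  keep := fun _ => true

/-- `0ⁿ`. [folklore] -/
def zeroBits (n : ℕ) : List Bool := List.replicate n false

/-- The transducer writes `0^{|u|}`. [cite: AroraBarakCC2009, §1.3] -/
theorem zeroBitsT_eval (u : List Bool) : zeroBitsT.eval u = zeroBits u.length := by
  have hrun : ∀ l : List Bool, zeroBitsT.run () l = ((), zeroBits l.length) := by
    intro l
    induction l with
    | nil => rfl
    | cons b l ih =>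
      rw [FST.run_cons]
      simp only [zeroBitsT] at ih ⊢
      rw [ih]
      rfl
  rw [FST.eval, show zeroBitsT.init = () from rfl, hrun u]
  rfl

/-- `|0ⁿ| = n`. [cite: AroraBarakCC2009, §1.3] -/
@[simp] theorem length_zeroBits (n : ℕ) : (zeroBits n).length = n := List.length_replicate

/-- `⟦0ⁿ⟧ = 0`. [cite: AroraBarakCC2009, §1.3] -/
@[simp] theorem bitsToNat_zeroBits (n : ℕ) : bitsToNat (zeroBits n) = 0 := bitsToNat_replicate_false n

/-- **The number `x` written in exactly `b` bits** (little-endian binary, zero-padded, truncated if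
`x ≥ 2^b`). [cite: AroraBarakCC2009, §1.3] -/
def blockE (b x : ℕ) : List Bool := (encodeNat x ++ zeroBits b).take b

/-- A block has exactly `b` bits. [cite: AroraBarakCC2009, Lemma 7.5 (points as strings of blocks)] -/
@[simp] theorem length_blockE (b x : ℕ) : (blockE b x).length = b := by
  simp [blockE, List.length_take]

/-- **The value of a block is the number**, when it fits. [cite: AroraBarakCC2009, Lemma 7.5 (points as strings of blocks)] -/
theorem bitsToNat_blockE {b x : ℕ} (hx : x < 2 ^ b) : bitsToNat (blockE b x) = x := by
  have hlen : (encodeNat x).length ≤ b := by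
    rw [TM2Pass.length_encodeNat_eq_size]; exact Nat.size_le.2 hx
  rw [blockE, List.take_append, List.take_of_length_le hlen, zeroBits, List.take_replicate,
    bitsToNat_append_replicate_false, bitsToNat_encodeNat]

/-- **The point segment** of a list of coordinates: `|xs|` consecutive blocks of `b` bits.
[cite: AroraBarakCC2009, Lemma 7.5 (evaluation point as a string)] -/
def segE (b : ℕ) (xs : List ℕ) : List Bool := (xs.map (blockE b)).flatten

/-- `|segE b xs| = |xs| · b`. [cite: AroraBarakCC2009, Lemma 7.5 (points as strings of blocks)] -/
@[simp] theorem length_segE (b : ℕ) (xs : List ℕ) : (segE b xs).length = xs.length * b := by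
  induction xs with
  | nil => simp [segE]
  | cons x xs ih =>
    simp only [segE, List.map_cons, List.flatten_cons, List.length_append, length_blockE,
      List.length_cons] at ih ⊢
    rw [ih]; ring

/-- `segE` of a cons. [folklore] -/
private theorem segE_cons (b x : ℕ) (xs : List ℕ) : segE b (x :: xs) = blockE b x ++ segE b xs := rfl

/-- `segE` of an append-singleton (the shape of a left fold). [folklore] -/
private theorem segE_append_singleton (b : ℕ) (xs : List ℕ) (x : ℕ) :
    segE b (xs ++ [x]) = segE b xs ++ blockE b x := by
  simp [segE]

/-- Dropping `i` blocks of a segment drops `i` coordinates. [folklore] -/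
private theorem drop_segE (b : ℕ) : ∀ (i : ℕ) (xs : List ℕ), (segE b xs).drop (i * b) = segE b (xs.drop i)
  | 0, xs => by simp
  | i + 1, [] => by simp [segE]
  | i + 1, x :: xs => by
    rw [segE_cons, List.drop_append, List.drop_eq_nil_of_le (by rw [length_blockE]; nlinarith),
      length_blockE, List.nil_append, show (i + 1) * b - b = i * b by rw [Nat.succ_mul, Nat.add_sub_cancel],
      List.drop_succ_cons]
    exact drop_segE b i xs

/-- **Block `i` of a segment is the block of coordinate `i`** (empty past the end) — the blocks the
tree's `ModularZeroTest.ptOf` reads. [cite: AroraBarakCC2009, Lemma 7.5 (the evaluation point as a string of blocks)] -/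
theorem blockOf_segE (b i : ℕ) (xs : List ℕ) :
    blockOf b i (segE b xs) = if h : i < xs.length then blockE b xs[i] else [] := by
  rw [blockOf, drop_segE]
  by_cases hi : i < xs.length
  · rw [dif_pos hi, List.drop_eq_getElem_cons hi, segE_cons,
      List.take_append_of_le_length (by rw [length_blockE]), List.take_of_length_le (by rw [length_blockE])]
  · rw [dif_neg hi, List.drop_eq_nil_of_le (by omega)]
    simp [segE]

/-- **The point read off a segment is the list of coordinates** (`0` past the end), when every
coordinate fits in `b` bits. [cite: AroraBarakCC2009, Lemma 7.5] -/
theorem ptOf_segE {b V : ℕ} {xs : List ℕ} (hxs : ∀ x ∈ xs, x < 2 ^ b) (i : Fin V) :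
    ptOf b V (segE b xs) i = ((xs.getD i.1 0 : ℕ) : ℤ) := by
  rw [ptOf, blockOf_segE]
  by_cases hi : (i : ℕ) < xs.length
  · rw [dif_pos hi, bitsToNat_blockE (hxs _ (List.getElem_mem hi)), List.getD_eq_getElem _ _ hi]
  · rw [dif_neg hi, List.getD_eq_default _ _ (by omega)]
    simp

/-! ### The codes of §1 -/

/-- `1ⁿ ↦ 0ⁿ` is computed on codes (a one-state transducer). [cite: AroraBarakCC2009, §1.3] -/
theorem zeroBitsFP : CodeFP unE strE zeroBits :=
  of_fn zeroBitsT.eval zeroBitsT.polyTimeComputable_eval fun n => by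
    rw [zeroBitsT_eval, length_unE]; rfl

/-- `(1ᵇ, x) ↦ blockE b x`. [cite: AroraBarakCC2009, §1.3] -/
theorem blockEFP : CodeFP (pairE unE natE) strE (fun p => blockE p.1 p.2) :=
  (strTake.comp ((fst _ _).pair (strAppend.comp ((strOfNat.comp (snd _ _)).pair
    (zeroBitsFP.comp (fst _ _)))))).congr fun _ => rfl

/-- `(1ᵇ, xs) ↦ segE b xs` (a left fold appending one block per coordinate; the accumulator never
exceeds `|xs| · b ≤ |input|²`). [cite: AroraBarakCC2009, §1.3 (bounded loops)] -/
theorem segEFP : CodeFP (pairE unE (rawE natE)) strE (fun p => segE p.1 p.2) := by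
  have hstep : CodeFP (pairE unE (pairE natE strE)) strE
      (fun t => t.2.2 ++ blockE t.1 t.2.1) :=
    strAppend.comp ((snd _ _).snd'.pair (blockEFP.comp ((fst _ _).pair (snd _ _).fst')))
  refine ((foldl (step := fun (b : ℕ) (x : ℕ) (acc : List Bool) => acc ++ blockE b x)
    (init := fun _ => ([] : List Bool)) hstep (const _ _) (Polynomial.X ^ 2) ?_)).congr ?_
  · intro b l₁ l₂
    have hfold : ∀ l : List ℕ, l.foldl (fun acc x => acc ++ blockE b x) [] = segE b l := by
      intro l
      induction l using List.reverseRecOn with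
      | nil => rfl
      | append_singleton l x ih => rw [List.foldl_append, List.foldl_cons, List.foldl_nil, ih,
          segE_append_singleton]
    rw [hfold, strE, id, length_segE, Polynomial.eval_pow, Polynomial.eval_X, pairE_apply, length_boolPair,
      length_unE]
    have h1 : l₁.length ≤ (rawE natE (l₁ ++ l₂)).length :=
      (List.sublist_append_left l₁ l₂).length_le.trans (length_le_length_rawE _ _)
    nlinarith [h1, Nat.zero_le (rawE natE (l₁ ++ l₂)).length]
  · intro p
    obtain ⟨b, xs⟩ := p
    simp only
    induction xs using List.reverseRecOn with
    | nil => rfl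
    | append_singleton l x ih => rw [List.foldl_append, List.foldl_cons, List.foldl_nil, ih,
        segE_append_singleton]

/-! ## §2 Typed point evaluation modulo an explicit modulus -/

/-- **The residue modulo `r` of the value of the circuit read off `w` at the point `xs`**
(coordinate `i ↦ xs.getD i 0`, written in blocks of `b` bits): the tree's `evalAtF` on the typed
context. [cite: BlaserIkenmeyerJindalLysikov2018, §6 (proof of Thm. 5, "by random evaluation")] -/
def evalPt (r : ℕ) (w : List Bool) (xs : List ℕ) (b : ℕ) : ℕ :=
  bitsToNat (evalAtF (mkCtx (encodeNat r) w (segE b xs) (ones b)))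

/-- **Specification of `evalPt`** (as an integer): for `2 ≤ r`, `|xs| = |w|` and coordinates `< 2^b`,
`evalPt r w xs b = (semPoly w)(xs) % r`. [cite: Schwartz1980, §3] [cite: AroraBarakCC2009, §1.3] -/
theorem evalPt_spec {r : ℕ} (hr : 2 ≤ r) {w : List Bool} {xs : List ℕ} {b : ℕ}
    (hlen : xs.length = w.length) (hxs : ∀ x ∈ xs, x < 2 ^ b) :
    (evalPt r w xs b : ℤ) =
      MvPolynomial.eval (fun i : Fin (Polynomial.X.eval w.length) => ((xs.getD i.1 0 : ℕ) : ℤ))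
        (semPoly w) % (r : ℤ) := by
  have hr' : 2 ≤ bitsToNat (encodeNat r) := by rwa [bitsToNat_encodeNat]
  have hseg : (segE b xs).length = Polynomial.X.eval w.length * b := by
    rw [length_segE, Polynomial.eval_X, hlen]
  have h := bitsToNat_evalAtF (encodeNat r) w (segE b xs) b hr' hseg
  rw [bitsToNat_encodeNat] at h
  have hpt : ptOf b (Polynomial.X.eval w.length) (segE b xs) =
      fun i : Fin (Polynomial.X.eval w.length) => ((xs.getD i.1 0 : ℕ) : ℤ) :=
    funext fun i => ptOf_segE hxs i
  rw [evalPt, h, hpt, Int.toNat_of_nonneg (Int.emod_nonneg _ (by exact_mod_cast (show r ≠ 0 by omega)))]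

/-- **The residue in `ZMod r`**: `evalPt` is the image of the integer value. [cite: BlaserIkenmeyerJindalLysikov2018, §6 (proof of Thm. 5, step 5: "switch to `𝔽_p`")] -/
theorem natCast_evalPt_zmod {r : ℕ} (hr : 2 ≤ r) {w : List Bool} {xs : List ℕ} {b : ℕ}
    (hlen : xs.length = w.length) (hxs : ∀ x ∈ xs, x < 2 ^ b) :
    ((evalPt r w xs b : ℕ) : ZMod r) =
      ((MvPolynomial.eval (fun i : Fin (Polynomial.X.eval w.length) => ((xs.getD i.1 0 : ℕ) : ℤ))
        (semPoly w) : ℤ) : ZMod r) := by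
  have h := evalPt_spec hr hlen hxs
  have h2 : ((evalPt r w xs b : ℕ) : ZMod r) = (((evalPt r w xs b : ℕ) : ℤ) : ZMod r) := by simp
  rw [h2, h, ZMod.intCast_mod]

/-- The residue is below the modulus (for `2 ≤ r`, `|xs| = |w|`): the evaluator's outputs stay short
in loops over many evaluations. [cite: AroraBarakCC2009, §1.3] -/
theorem evalPt_lt {r : ℕ} (hr : 2 ≤ r) {w : List Bool} {xs : List ℕ} (b : ℕ)
    (hlen : xs.length = w.length) : evalPt r w xs b < r := by
  have hr' : 2 ≤ bitsToNat (encodeNat r) := by rwa [bitsToNat_encodeNat]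
  have hseg : (segE b xs).length = Polynomial.X.eval w.length * b := by
    rw [length_segE, Polynomial.eval_X, hlen]
  have h := bitsToNat_evalAtF_lt (encodeNat r) w (segE b xs) b hr' hseg
  rwa [bitsToNat_encodeNat] at h

/-- **`(r, w, xs, 1ᵇ) ↦ evalPt r w xs b` is computed on codes.** [cite: AroraBarakCC2009, §1.3] -/
theorem evalPtFP : CodeFP (pairE natE (pairE strE (pairE (rawE natE) unE))) natE
    (fun t => evalPt t.1 t.2.1 t.2.2.1 t.2.2.2) := by
  -- the context `⟨bin r, ⟨w, ⟨segE b xs, 1ᵇ⟩⟩⟩` has the code `pairE natE (pairE strE (pairE strE unE))`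
  have hctx : CodeFP (pairE natE (pairE strE (pairE (rawE natE) unE)))
      (pairE natE (pairE strE (pairE strE unE)))
      (fun t => (t.1, t.2.1, segE t.2.2.2 t.2.2.1, t.2.2.2)) :=
    (fst _ _).pair ((snd _ _).fst'.pair ((segEFP.comp ((snd _ _).snd'.snd'.pair (snd _ _).snd'.fst')).pair
      (snd _ _).snd'.snd'))
  have hev : CodeFP (pairE natE (pairE strE (pairE strE unE))) natE
      (fun c => bitsToNat (evalAtF (mkCtx (encodeNat c.1) c.2.1 c.2.2.1 (ones c.2.2.2)))) :=
    strVal.comp (of_fn (eβ := strE) evalAtF evalAtF_mem_FP fun c => by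
      simp only [pairE_apply, strE, id, mkCtx, unE_eq_ones])
  exact (hev.comp hctx).congr fun t => rfl

/-! ## §3 Typed formal-degree test -/

/-- **The formal-degree test** `[formalDegree (rdCircuit V w) ≤ d]` (the formal degree of the read
circuit does not depend on the number `V` of variables offered; we fix `V = |w|`).
[cite: BlaserIkenmeyerJindalLysikov2018, §6 (proof of Thm. 5, step 2)] -/
def fdegLe (w : List Bool) (d : ℕ) : Bool :=
  decide ((rdCircuit (Polynomial.X.eval w.length) w).formalDegree ≤ d)

/-- The test against any variable bound `V`. [cite: Burgisser2006, §2.2] -/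
theorem fdegLe_eq (V : ℕ) (w : List Bool) (d : ℕ) :
    fdegLe w d = decide ((rdCircuit V w).formalDegree ≤ d) := by
  have h1 := fdegLeF_spec (Polynomial.X.eval w.length) w (encodeNat d)
  have h2 := fdegLeF_spec V w (encodeNat d)
  rw [bitsToNat_encodeNat] at h1 h2
  have h := h1.symm.trans h2
  rw [List.cons.injEq] at h
  rw [fdegLe]
  exact h.1

/-- On a genuine code word: the formal degree of the coded circuit. [cite: BlaserIkenmeyerJindalLysikov2018, §6 (proof of Thm. 5, step 2)] -/
theorem fdegLe_circuitWord {m : ℕ} (C : ArithCircuit ℤ (Fin m)) (d : ℕ) :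
    fdegLe (KIReduction.circuitWord m C) d = decide (C.formalDegree ≤ d) := by
  have h := fdegLeF_circuitWord (le_refl m) C (encodeNat d)
  rw [fdegLeF_spec m, bitsToNat_encodeNat, List.cons.injEq] at h
  rw [fdegLe_eq m]
  exact h.1

/-- **`(w, d) ↦ fdegLe w d` is computed on codes.** [cite: AroraBarakCC2009, §1.3] -/
theorem fdegLeFP : CodeFP (pairE strE natE) bitE (fun p => fdegLe p.1 p.2) :=
  of_fn fdegLeF fdegLeF_mem_FP fun p => by
    rw [pairE_apply, fdegLeF_spec (Polynomial.X.eval p.1.length), bitsToNat_encodeNat]; rfl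

/-! ## §4 Primality in binary

Already in the tree, by name: `Literature.Computability.Cryptography.VDSOracle.codeFP_prime :
CodeFP natE bitE (fun n => decide n.Prime)` (`Cryptography/VanDamSeroussiOracleFP.lean`); a
verifier imports it rather than a copy. -/

end CircuitCode

end Literature.Computability.AlgebraicComplexity
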